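import Summits.NavierStokesRegularity.NavierStokesRegularity.Theses.AxisymmetricExtremality
import Summits.NavierStokesRegularity.NavierStokesRegularity.Theorems.AxisymmetricExtremalityAxisymmetricKatoGlobalStubSeregin2020TypeIISwirlVanishesV2
import Summits.NavierStokesRegularity.NavierStokesRegularity.Theorems.AxisymmetricExtremalityAxisymmetricKatoGlobalStubSeregin2020TypeIIAncientLimitSwirlBounded
import Summits.NavierStokesRegularity.NavierStokesRegularity.Theorems.AxisymmetricExtremalityAxisymmetricKatoGlobalStubSeregin2020TypeIINoSwirlEndgameHolds
import Summits.NavierStokesRegularity.NavierStokesRegularity.Theorems.AxisymmetricExtremalityAxisymmetricKatoGlobalStubSeregin2020TypeIILemma22GaussProfile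
import HarnessLib

/-!
# Seregin 2020, Thm 2.1 modulo Lemma 2.2 (CORRECTED rendering: supersolutions, drift norm on
# `B(2R)`, `div U = 0`): the blow-up index at the singular origin is `∞` (Type II)

Helper toward the stub `stub_seregin2020TypeII` of the crux `AxisymmetricKatoGlobal` (= the named
fact `Literature.Analysis.FluidPDE.Seregin2020_axisymmetricSingularPoint_typeII`, G. Seregin,
Anal. Math. Phys. 10 (2020) Paper 46 = arXiv:2006.04140, Thm 2.1). This file SUPERSEDES the
sibling `…SwirlVanishesFinal` (`blowupIndex_eq_top_of_weakHarnack`, p171401), whose written-out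
Lemma-2.2 hypothesis `hWH` renders (2.12) with the printed SUBsolution sign and is refutable as
stated (`not_weakHarnack_subsolution`, p172360), so that theorem is vacuously hypothesised. The
final assembly of the printed proof of Thm 2.1 with its one remaining unproved ingredient,
Lemma 2.2 (the Nazarov–Uraltseva-type propagation of a lower bound from the axis for
SUPERsolutions `∂ₜπ + (u + 2x'/|x'|²)·∇π - Δπ ≥ 0` in the class 𝒱), kept as an explicitly
WRITTEN-OUT hypothesis — the corrected `∀`-statement `hWH′` of
`ae_swirl_eq_zero_of_weakHarnack'` (sibling `…SwirlVanishesV2`, where the three corrected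
clauses (a) supersolution sign, (b) drift norm on `B(2R) × ]-R², 0[`, (c) `div U = 0` off the
axis, and the correspondence with the printed lemma and with N–U Lemma 4.2 are documented):

* `gaussX_not_supersolution` — sanity check of the corrected clause (a): the witness of the
  refutation p172360 (the planar Gaussian `e^{-L|x'|²}`, zero drift) violates the SUPERsolution
  inequality off the axis (`(2/ϱ)∂_ϱΦ - ΔΦ = -4L²ϱ²e^{-Lϱ²} < 0`), so it does not refute `hWH′`;
* `blowupIndex_eq_top_of_weakHarnack'` — (H) the eight hypotheses of Thm 2.1 and the corrected
  Lemma 2.2 ⟹ `Seregin2020.blowupIndex 0 u G = ∞`.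

Proof: if `g(0) < ∞` (Type I), the first half of the printed proof gives the ancient axisymmetric
limit `(w, π)` with (𝒜), (2.8), (2.9) and the singular origin
(`exists_ancientLimit_isAxisymmetric_swirl_bounded`); Lemma 2.2 gives `Γ ≡ 0`
(`ae_swirl_eq_zero_of_weakHarnack'`); the no-swirl endgame (`false_of_ae_swirl_eq_zero`:
swirl-free axisymmetric local energy ancient solutions are backward regular, against (2.9)) is a
contradiction. Hence, once Lemma 2.2 is proved in the tree in the corrected rendered form
`lemma22 : hWH′`, the named fact `Seregin2020_axisymmetricSingularPoint_typeII` follows by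
`fun u p G h₁ … h₈ => blowupIndex_eq_top_of_weakHarnack' u p G h₁ … h₈ lemma22`.

## References

* G. Seregin, Anal. Math. Phys. 10 (2020), Paper 46 = arXiv:2006.04140, Thm. 2.1 and its proof,
  Lemma 2.2 (arXiv pp. 4–8). [Seregin2020]
* A. I. Nazarov, N. N. Uraltseva, St. Petersburg Math. J. 23 (2012) 93–115 = arXiv:1011.1888,
  Lemma 4.2. [NazarovUraltseva2012]
-/

-- the problem directory repeats the summit name (D-0017); core's `dupNamespace` linter fires
set_option linter.dupNamespace false

noncomputable section

open MeasureTheory Set Function Filter Topology TopologicalSpace Metric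
open scoped NNReal ENNReal Laplacian

namespace Summit.NavierStokesRegularity.NavierStokesRegularity.Theorems.AxisymmetricKatoGlobal.EulerScaling

open Literature.Analysis.FluidPDE Literature.Analysis.FluidPDE.Seregin2020

/-! ### Sanity check: the Gauss profile of p172360 is not a supersolution -/

/-- **The witness of `not_weakHarnack_subsolution` violates the corrected clause (a).** For the
planar Gaussian `Φ = e^{-L(x₀² + x₁²)}`, `L ≠ 0`, with zero drift, off the axis
`DΦ[0] + (2/ϱ)∂_ϱΦ - ΔΦ = -4L²ϱ² e^{-Lϱ²} < 0` (`two_div_mul_fderiv_gaussX_eR`,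
`laplacian_gaussX`): the profile is a strict SUBsolution (`gaussX_subsolution`), not a
supersolution, so the counterexample to the printed rendering `hWH` does not touch `hWH′`.
[folklore] -/
theorem gaussX_not_supersolution : ∀ (L : ℝ), L ≠ 0 → ∀ x : EuclideanSpace ℝ (Fin 3),
    cylRadius x ≠ 0 →
    fderiv ℝ (fun y : EuclideanSpace ℝ (Fin 3) => Real.exp (-(L * (y 0 ^ 2 + y 1 ^ 2)))) x 0 +
        2 / cylRadius x * partialDeriv (eR x) (fun y : EuclideanSpace ℝ (Fin 3) =>
          Real.exp (-(L * (y 0 ^ 2 + y 1 ^ 2)))) x -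
        (Laplacian.laplacian (fun y : EuclideanSpace ℝ (Fin 3) =>
          Real.exp (-(L * (y 0 ^ 2 + y 1 ^ 2))))) x < 0 := by
  intro L hL x hx
  rw [map_zero, partialDeriv, two_div_mul_fderiv_gaussX_eR L hx, laplacian_gaussX]
  have hE : 0 < Real.exp (-(L * (x 0 ^ 2 + x 1 ^ 2))) := Real.exp_pos _
  have hq : 0 < x 0 ^ 2 + x 1 ^ 2 := by
    rw [← cylRadius_sq]
    positivity
  have hL2 : 0 < L ^ 2 := by positivity
  nlinarith [mul_pos (mul_pos hL2 hq) hE]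

/-! ### The main theorem -/

/-- **Seregin 2020, Thm 2.1, modulo Lemma 2.2 as a written-out hypothesis — CORRECTED rendering
`hWH′`.** Supersedes `blowupIndex_eq_top_of_weakHarnack` (vacuous hypothesis, p172360). Let
`(u, p)` be a suitable weak solution of the Navier–Stokes equations in `Q = 𝒞 × ]-1, 0[` in the
sense of Def. 1.3 (suitable on `Q`, `u ∈ L_{2,∞}(Q)`, weak spatial gradient `G ∈ L₂(Q)`,
`p ∈ L_{3/2}(Q)`), axisymmetric, with the origin a (backward) singular point — the hypotheses (H)
of the named fact `Seregin2020_axisymmetricSingularPoint_typeII` —, and ASSUME Lemma 2.2 of the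
paper in the corrected rendered form of `ae_swirl_eq_zero_of_weakHarnack'` (hypothesis `hWH′`:
SUPERsolutions `∂ₜΦ + (U + 2x'/|x'|²)·∇Φ - ΔΦ ≥ 0` off the axis, drift norm
`∫_{-R²}^0 (∫_{B(2R)} |u|³)^{4/3} ≤ N R²`, `div U = 0` off the axis; see there). Then the origin
is a Type II blow-up: `g(0) = min{limsup E, limsup A, limsup C} = ∞`
(`Seregin2020.blowupIndex 0 u G = ∞`). Proof: a finite blow-up index yields the ancient
axisymmetric limit with bounded swirl (`exists_ancientLimit_isAxisymmetric_swirl_bounded`), whose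
swirl vanishes by Lemma 2.2 (`ae_swirl_eq_zero_of_weakHarnack'`), contradicting the no-swirl
endgame (`false_of_ae_swirl_eq_zero`). [cite: Seregin2020, Thm 2.1 and its proof (arXiv pp. 4–8)] -/
theorem blowupIndex_eq_top_of_weakHarnack' :
    ∀ (u : ℝ → EuclideanSpace ℝ (Fin 3) → EuclideanSpace ℝ (Fin 3))
      (p : ℝ → EuclideanSpace ℝ (Fin 3) → ℝ)
      (G : ℝ → EuclideanSpace ℝ (Fin 3) → EuclideanSpace ℝ (Fin 3) →L[ℝ] EuclideanSpace ℝ (Fin 3)),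
      IsSuitableWeakSolutionOn (SereginSverak2009.parCylOpens 0 1) 1 0 u p →
      (∃ C : ℝ≥0, ∀ᵐ t ∂(volume.restrict (Ioo (-1 : ℝ) 0)),
        ∫⁻ x in SereginSverak2009.spaceCyl 0 1, ‖u t x‖ₑ ^ 2 ≤ C) →
      HasWeakSpatialGradientOn (SereginSverak2009.parCylOpens 0 1) u G →
      (∫⁻ z in SereginSverak2009.parCyl 0 1, ENNReal.ofReal (frobeniusNormSq (G z.1 z.2)) < ∞) →
      (∫⁻ z in SereginSverak2009.parCyl 0 1, ‖p z.1 z.2‖ₑ ^ (3 / 2 : ℝ) < ∞) →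
      (∀ t ∈ Ioo (-1 : ℝ) 0, IsAxisymmetric (u t)) →
      (∀ t ∈ Ioo (-1 : ℝ) 0, IsAxisymmetricScalar (p t)) →
      IsBackwardSingularPoint u 0 →
      -- Lemma 2.2 of the paper, written out (verbatim as in `ae_swirl_eq_zero_of_weakHarnack'`)
      (∀ (M : ℝ) (N : ℝ≥0), ∃ β : ℝ, 0 < β ∧
        ∀ (u U : ℝ → EuclideanSpace ℝ (Fin 3) → EuclideanSpace ℝ (Fin 3))
          (p : ℝ → EuclideanSpace ℝ (Fin 3) → ℝ) (K : ℝ≥0)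
          (Φ : ℝ → EuclideanSpace ℝ (Fin 3) → ℝ) (S : Set (ℝ × EuclideanSpace ℝ (Fin 3))) (R k : ℝ),
          (∀ s, IsAxisymmetric (u s)) → (∀ s, IsAxisymmetricScalar (p s)) →
          (∀ a : ℝ, 0 < a →
            IsSuitableWeakSolutionInBall a 0 u p ∧
            cknAEss a 0 u ≤ K ∧
            cknC a 0 u ≤ K ∧
            cknD a 0 p ≤ K ∧
            ∃ G' : ℝ → EuclideanSpace ℝ (Fin 3) →
                EuclideanSpace ℝ (Fin 3) →L[ℝ] EuclideanSpace ℝ (Fin 3),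
              HasWeakSpatialGradientOn (parabolicCylinderOpens (2 * a) 0) u G' ∧
                cknAEss a 0 u + cknE a 0 G' ≤ K) →
          uncurry u =ᵐ[volume.restrict {z : ℝ × EuclideanSpace ℝ (Fin 3) | z.1 < 0}] uncurry U →
          ContinuousOn (uncurry U)
            {z : ℝ × EuclideanSpace ℝ (Fin 3) | z.1 < 0 ∧ cylRadius z.2 ≠ 0} →
          (∀ z : ℝ × EuclideanSpace ℝ (Fin 3), z.1 < 0 → cylRadius z.2 ≠ 0 →
            ContDiffAt ℝ (⊤ : ℕ∞) (U z.1) z.2) →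
          ContinuousOn (fun z : ℝ × EuclideanSpace ℝ (Fin 3) => fderiv ℝ (U z.1) z.2)
            {z : ℝ × EuclideanSpace ℝ (Fin 3) | z.1 < 0 ∧ cylRadius z.2 ≠ 0} →
          (∀ z : ℝ × EuclideanSpace ℝ (Fin 3), z.1 < 0 → cylRadius z.2 ≠ 0 →
            VectorCalculus.divergence (U z.1) z.2 = 0) →
          IsClosed S → (∀ z ∈ S, z.1 ≤ 0 ∧ cylRadius z.2 = 0) → IsParabolicNull 1 S →
          ContinuousOn (uncurry Φ) ({z : ℝ × EuclideanSpace ℝ (Fin 3) | z.1 < 0} \ S) →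
          (∀ z : ℝ × EuclideanSpace ℝ (Fin 3), z.1 < 0 → z ∉ S →
            ContDiffAt ℝ (⊤ : ℕ∞) (Φ z.1) z.2) →
          ContinuousOn (fun z : ℝ × EuclideanSpace ℝ (Fin 3) => fderiv ℝ (Φ z.1) z.2)
            ({z : ℝ × EuclideanSpace ℝ (Fin 3) | z.1 < 0} \ S) →
          (∀ e : EuclideanSpace ℝ (Fin 3), ContinuousOn (fun z : ℝ × EuclideanSpace ℝ (Fin 3) =>
              fderiv ℝ (fun y => fderiv ℝ (Φ z.1) y e) z.2 e)
            ({z : ℝ × EuclideanSpace ℝ (Fin 3) | z.1 < 0} \ S)) →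
          (∀ z : ℝ × EuclideanSpace ℝ (Fin 3), z.1 < 0 → cylRadius z.2 ≠ 0 →
            DifferentiableAt ℝ (fun r => Φ r z.2) z.1) →
          ContinuousOn (fun z : ℝ × EuclideanSpace ℝ (Fin 3) => deriv (fun r => Φ r z.2) z.1)
            {z : ℝ × EuclideanSpace ℝ (Fin 3) | z.1 < 0 ∧ cylRadius z.2 ≠ 0} →
          (∀ δ ρ : ℝ, 0 < δ → δ < ρ → ∃ C : ℝ, ∀ z : ℝ × EuclideanSpace ℝ (Fin 3),
            z.1 ∈ Ioo (-ρ ^ 2) 0 → δ < cylRadius z.2 → cylRadius z.2 < ρ → |z.2 2| < ρ →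
              |deriv (fun r => Φ r z.2) z.1| ≤ C ∧ ‖fderiv ℝ (Φ z.1) z.2‖ ≤ C ∧
              ∀ e : EuclideanSpace ℝ (Fin 3), ‖e‖ ≤ 1 →
                |fderiv ℝ (fun y => fderiv ℝ (Φ z.1) y e) z.2 e| ≤ C) →
          (∃ B : ℝ, ∀ z : ℝ × EuclideanSpace ℝ (Fin 3), z.1 < 0 → z ∉ S → |Φ z.1 z.2| ≤ B) →
          (∀ z : ℝ × EuclideanSpace ℝ (Fin 3), z.1 < 0 → z ∉ S → 0 ≤ Φ z.1 z.2) →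
          (∀ z : ℝ × EuclideanSpace ℝ (Fin 3), z.1 < 0 → cylRadius z.2 ≠ 0 →
            0 ≤ deriv (fun r => Φ r z.2) z.1 + fderiv ℝ (Φ z.1) z.2 (U z.1 z.2) +
                2 / cylRadius z.2 * partialDeriv (eR z.2) (Φ z.1) z.2 - (Laplacian.laplacian (Φ z.1)) z.2) →
          0 < R → 0 < k → 1 ≤ M →
          (∫⁻ s in Ioo (-R ^ 2) 0, (∫⁻ y in ball (0 : EuclideanSpace ℝ (Fin 3)) (2 * R),
              ‖u s y‖ₑ ^ (3 : ℕ)) ^ (4 / 3 : ℝ) ≤ (N : ℝ≥0∞) * ENNReal.ofReal R ^ 2) →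
          (∀ z : ℝ × EuclideanSpace ℝ (Fin 3), z.1 ∈ Ioo (-R ^ 2) 0 → cylRadius z.2 = 0 →
            z.2 2 ∈ Ioo (-(2 * R)) (2 * R) → z ∉ S → k ≤ Φ z.1 z.2) →
          (∀ z : ℝ × EuclideanSpace ℝ (Fin 3), z.1 ∈ Ioo (-R ^ 2) 0 →
            z.2 ∈ ball (0 : EuclideanSpace ℝ (Fin 3)) (2 * R) → z ∉ S → Φ z.1 z.2 ≤ M * k) →
          ∀ᵐ z ∂(volume.restrict (parabolicCylinder (R / 2) (0 : ℝ × EuclideanSpace ℝ (Fin 3)))),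
            β * k ≤ Φ z.1 z.2) →
      Seregin2020.blowupIndex 0 u G = ∞ := by
  -- adapted from …Theorems/AxisymmetricExtremalityAxisymmetricKatoGlobalStubSeregin2020TypeIISwirlVanishesFinal
  -- (`blowupIndex_eq_top_of_weakHarnack`): same proof, with the corrected `Γ ≡ 0` step
  intro u p G hsw hA hG hE hp hu_ax hp_ax hsing hWH
  by_contra hne
  have hI : Seregin2020.blowupIndex 0 u G < ∞ := lt_top_iff_ne_top.2 hne
  obtain ⟨c, K, κ, lam, w, π, -, -, -, hsing', hax, hπax, hall⟩ :=
    exists_ancientLimit_isAxisymmetric_swirl_bounded u p G hsw hA hG hE hp hu_ax hp_ax hsing hI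
  have hzero := ae_swirl_eq_zero_of_weakHarnack' w π K c hax hπax
    (fun a ha => ⟨(hall a ha).1, (hall a ha).2.2.2.2.1, (hall a ha).2.2.2.2.2.1,
      (hall a ha).2.2.2.2.2.2.1, (hall a ha).2.2.2.2.2.2.2.1, (hall a ha).2.2.2.2.2.2.2.2.2⟩) hWH
  exact false_of_ae_swirl_eq_zero u w p π K κ lam hax hsing'
    (fun a ha => ⟨(hall a ha).1, (hall a ha).2.1, (hall a ha).2.2.1, (hall a ha).2.2.2.1,
      (hall a ha).2.2.2.2.1, (hall a ha).2.2.2.2.2.1, (hall a ha).2.2.2.2.2.2.1,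
      (hall a ha).2.2.2.2.2.2.2.1, (hall a ha).2.2.2.2.2.2.2.2.1⟩) hzero

end Summit.NavierStokesRegularity.NavierStokesRegularity.Theorems.AxisymmetricKatoGlobal.EulerScaling

end
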